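import Summits.KontsevichZagierPeriods.KontsevichZagierPeriods.Theses.FurushoPentagon
import Summits.KontsevichZagierPeriods.KontsevichZagierPeriods.Theorems.FurushoPentagonReducedPeriodRingDefs
import Literature.NumberTheory.Transcendental.KZCubicalCalculus
import Literature.NumberTheory.Transcendental.KZLogCalculusProofs
import Literature.Analysis.Complex.PuiseuxAtInfinityAtlas
import Literature.Analysis.Complex.AlgebraicFunctionContinuation

/-!
# `SectorToKernel`, line `effective-cube-surjection`, dimension-one rung: real Puiseux normal form (R1)

We prove `stub_puiseuxRight`: a real function `f`, continuous on `(a, a + δ)` and satisfying a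
non-trivial polynomial relation `P(s, f s) = 0` there, has, after the substitution `s = a + tᵉ`,
the NEWTON–PUISEUX NORMAL FORM to the right of `a`: on some `(0, r)` either `f (a + tᵉ) = 0`, or
`f (a + tᵉ) = tᵐ · G t` with `m ∈ ℤ`, `G` real-analytic on `(-r, r)` and `G 0 ≠ 0`.

Proof. (1) Complexify `P` and send `a` to infinity by `x = a + 1/u`: the polynomial
`Q(u, v) = u^D P(a + 1/u, v) ∈ ℂ[u, v]` is non-zero (`puiseuxR_complexify`). (2) The tree's
finite atlas of Puiseux branches at infinity (`PuiseuxInfinity.exists_branch_atlas`) gives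
`e ≥ 1` and finitely many candidates `y(t)/t^M`, `y` holomorphic near `0`, such that for every
small real `t > 0` the value `f (a + tᵉ)` is one of the candidate values at `t`. (3) Two candidates
either agree or disagree identically near `0⁺` (isolated zeros, `puiseuxR_dichotomy`), so by
continuity of `f` and connectedness of an interval ONE candidate computes `f (a + tᵉ)` on a whole
interval `(0, ρ)` (`puiseuxR_select`). (4) Factor `y(t) = t^N g(t)`, `g(0) ≠ 0` (order of
vanishing), and take real parts: `g` is real on `(0, ρ)`, hence `g(0)` is real by continuity.

## References

* E. Brieskorn, H. Knörrer, *Plane Algebraic Curves*, Birkhäuser 1986, §8.3. [folklore]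
-/

noncomputable section

namespace Summit.KontsevichZagierPeriods.FurushoPentagon.SectorToKernel

open Set MeasureTheory
open Literature.NumberTheory.Transcendental
open Literature.NumberTheory.Transcendental.KZ hiding cubicalSpan
open Summit.KontsevichZagierPeriods.KontsevichZagierPeriods.Theses.FurushoPentagon
open Summit.KontsevichZagierPeriods.FurushoPentagon.ReducedPeriodRing (unitCube cubicalGens cubicalSpan)
open Filter Topology

/-- **Complexification and the substitution `x = a + 1/u`.** For a non-zero real
`P ∈ ℝ[x, y]` and `a ∈ ℝ` there is a non-zero complex `Q ∈ ℂ[u, v]` (namely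
`Q(u, v) = u^D P(a + 1/u, v)`, `D = deg_x P`) with `Q((x - a)⁻¹, y) = (x - a)^{-D} P(x, y)` for real
`x ≠ a`, `y`. [folklore] -/
theorem puiseuxR_complexify (P : MvPolynomial (Fin 2) ℝ) (hP : P ≠ 0) (a : ℝ) :
    ∃ Q : MvPolynomial (Fin 2) ℂ, Q ≠ 0 ∧ ∃ D : ℕ, ∀ x y : ℝ, x ≠ a →
      MvPolynomial.eval ![((x - a : ℝ) : ℂ)⁻¹, (y : ℂ)] Q =
        ((x - a : ℝ) : ℂ)⁻¹ ^ D * ((MvPolynomial.eval ![x, y] P : ℝ) : ℂ) := by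
  classical
  set D : ℕ := P.degreeOf 0 with hD
  have hP2 : ∀ x y : ℝ, MvPolynomial.eval ![x, y] P =
      ∑ d ∈ P.support, P.coeff d * (x ^ d 0 * y ^ d 1) := fun x y => by
    rw [MvPolynomial.eval_eq']
    simp only [Fin.prod_univ_two, Matrix.cons_val_zero, Matrix.cons_val_one]
  have hval : ∀ x y : ℝ, x ≠ a →
      MvPolynomial.eval ![((x - a : ℝ) : ℂ)⁻¹, (y : ℂ)]
        (∑ d ∈ P.support, MvPolynomial.C ((P.coeff d : ℝ) : ℂ) *
          ((MvPolynomial.C (a : ℂ) * MvPolynomial.X 0 + 1) ^ (d 0) *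
            MvPolynomial.X 0 ^ (D - d 0) * MvPolynomial.X 1 ^ (d 1))) =
        ((x - a : ℝ) : ℂ)⁻¹ ^ D * ((MvPolynomial.eval ![x, y] P : ℝ) : ℂ) := by
    intro x y hxa
    have hw : (x : ℂ) - a ≠ 0 := by
      rw [sub_ne_zero]
      exact_mod_cast hxa
    set u : ℂ := ((x - a : ℝ) : ℂ)⁻¹ with hu
    have hu' : u = ((x : ℂ) - a)⁻¹ := by rw [hu, Complex.ofReal_sub]
    have hxu : (a : ℂ) * u + 1 = x * u := by
      rw [hu']
      field_simp
      ring
    rw [hP2 x y]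
    push_cast
    rw [map_sum, Finset.mul_sum]
    refine Finset.sum_congr rfl fun d hd => ?_
    have hd0 : d 0 ≤ D := MvPolynomial.monomial_le_degreeOf 0 hd
    have hDu : u ^ D = u ^ (d 0) * u ^ (D - d 0) := by
      rw [← pow_add]
      congr 1
      omega
    simp only [map_mul, map_pow, map_add, map_one, MvPolynomial.eval_C, MvPolynomial.eval_X,
      Matrix.cons_val_zero, Matrix.cons_val_one]
    rw [hxu, hDu]
    ring
  refine ⟨_, fun hQ0 => ?_, D, hval⟩
  -- a point off the line `x = a` at which `P` does not vanish
  obtain ⟨z, hza, hzP⟩ : ∃ z : Fin 2 → ℝ, z 0 ≠ a ∧ MvPolynomial.eval z P ≠ 0 := by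
    by_contra! h
    refine hP (MvPolynomial.funext_set ![({a}ᶜ : Set ℝ), Set.univ] ?_ fun w hw => ?_)
    · intro i
      fin_cases i
      · exact (Set.finite_singleton a).infinite_compl
      · exact Set.infinite_univ
    · rw [map_zero]
      exact h w (hw 0 (Set.mem_univ _))
  have hz : z = ![z 0, z 1] := by
    funext i
    fin_cases i <;> rfl
  have h1 := hval (z 0) (z 1) hza
  rw [hQ0, map_zero, ← hz] at h1
  have hw : ((z 0 - a : ℝ) : ℂ) ≠ 0 := by exact_mod_cast sub_ne_zero.2 hza
  have h2 := (mul_eq_zero.1 h1.symm).resolve_left (pow_ne_zero D (inv_ne_zero hw))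
  exact hzP (by exact_mod_cast h2)

/-- The embedding `t ↦ (t : ℂ)` maps the right half-neighbourhoods of `0 ∈ ℝ` into the punctured
neighbourhoods of `0 ∈ ℂ`. [folklore] -/
theorem puiseuxR_tendsto_ofReal :
    Tendsto (fun t : ℝ => (t : ℂ)) (𝓝[>] 0) (𝓝[≠] 0) := by
  refine tendsto_nhdsWithin_iff.2 ⟨?_, ?_⟩
  · exact (Complex.continuous_ofReal.tendsto' (0 : ℝ) 0 Complex.ofReal_zero).mono_left
      nhdsWithin_le_nhds
  · filter_upwards [self_mem_nhdsWithin] with t ht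
    exact Complex.ofReal_ne_zero.2 (ne_of_gt ht)

/-- **Isolated zeros, real form.** A function holomorphic at `0 ∈ ℂ` either vanishes at all
small real `t > 0` or at no small real `t > 0`. [folklore] -/
theorem puiseuxR_dichotomy {g : ℂ → ℂ} (hg : AnalyticAt ℂ g 0) :
    (∀ᶠ t : ℝ in 𝓝[>] 0, g t = 0) ∨ (∀ᶠ t : ℝ in 𝓝[>] 0, g t ≠ 0) := by
  rcases hg.eventually_eq_zero_or_eventually_ne_zero with h | h
  · exact Or.inl ((puiseuxR_tendsto_ofReal.mono_right nhdsWithin_le_nhds).eventually h)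
  · exact Or.inr (puiseuxR_tendsto_ofReal.eventually h)

/-- **Branch selection by continuity.** If a continuous function `F` on a preconnected open
set `S ⊆ ℝ` takes at every point the value of one of finitely many continuous candidates
`H b`, `b ∈ B`, and any two candidates either agree on all of `S` or disagree on all of `S`,
then `F` is ONE of the candidates on `S`. [folklore] -/
theorem puiseuxR_select {ι : Type*} (B : Finset ι) (H : ι → ℝ → ℂ) (F : ℝ → ℂ) {S : Set ℝ}
    (hS : IsOpen S) (hSc : IsPreconnected S) (hne : S.Nonempty) (hF : ContinuousOn F S)
    (hH : ∀ b ∈ B, ContinuousOn (H b) S)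
    (hdich : ∀ b ∈ B, ∀ b' ∈ B, (∀ t ∈ S, H b t = H b' t) ∨ (∀ t ∈ S, H b t ≠ H b' t))
    (hcov : ∀ t ∈ S, ∃ b ∈ B, F t = H b t) :
    ∃ b ∈ B, ∀ t ∈ S, F t = H b t := by
  classical
  obtain ⟨t₀, ht₀⟩ := hne
  obtain ⟨b₀, hb₀, h₀⟩ := hcov t₀ ht₀
  refine ⟨b₀, hb₀, ?_⟩
  have hopen : ∀ b ∈ B, IsOpen {t | t ∈ S ∧ F t ≠ H b t} := fun b hb => by
    have h := (hF.sub (hH b hb)).isOpen_inter_preimage hS (isOpen_compl_singleton (x := (0 : ℂ)))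
    convert h using 1
    ext t
    simp [sub_eq_zero]
  set B' : Finset ι := B.filter fun b => ¬ ∀ t ∈ S, H b₀ t = H b t with hB'
  have hB'mem : ∀ b ∈ B, (∀ t ∈ S, H b₀ t ≠ H b t) → b ∈ B' := fun b hb h => by
    rw [hB', Finset.mem_filter]
    exact ⟨hb, fun h' => h t₀ ht₀ (h' t₀ ht₀)⟩
  set U : Set ℝ := {t | t ∈ S ∧ F t ≠ H b₀ t} with hU
  set V : Set ℝ := S ∩ ⋂ b ∈ B', {t | t ∈ S ∧ F t ≠ H b t} with hV
  have hUo : IsOpen U := hopen b₀ hb₀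
  have hVo : IsOpen V :=
    hS.inter (isOpen_biInter_finset fun b hb => hopen b (Finset.mem_filter.1 hb).1)
  have hdisj : Disjoint U V := by
    rw [Set.disjoint_left]
    rintro t ⟨htS, htU⟩ ⟨-, htV⟩
    obtain ⟨b, hb, hFb⟩ := hcov t htS
    rcases hdich b₀ hb₀ b hb with h | h
    · exact htU (hFb.trans (h t htS).symm)
    · exact (Set.mem_iInter₂.1 htV b (hB'mem b hb h)).2 hFb
  have hcover : S ⊆ U ∪ V := by
    intro t htS
    by_cases h : F t = H b₀ t
    · refine Or.inr ⟨htS, Set.mem_iInter₂.2 fun b hb => ⟨htS, fun h' => ?_⟩⟩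
      obtain ⟨hbB, hb'⟩ := Finset.mem_filter.1 hb
      rcases hdich b₀ hb₀ b hbB with h'' | h''
      · exact hb' h''
      · exact h'' t htS (h.symm.trans h')
    · exact Or.inl ⟨htS, h⟩
  rcases hSc.subset_or_subset hUo hVo hdisj hcover with h | h
  · exact absurd h₀ (h ht₀).2
  · intro t htS
    obtain ⟨-, htV⟩ := h htS
    obtain ⟨b, hb, hFb⟩ := hcov t htS
    rcases hdich b₀ hb₀ b hb with h' | h'
    · exact hFb.trans (h' t htS).symm
    · exact absurd hFb (Set.mem_iInter₂.1 htV b (hB'mem b hb h')).2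

/-- **R1 (real Puiseux normal form to the right of a point).** A continuous real function
satisfying a non-trivial polynomial relation `P(s, f s) = 0` on `(a, a + δ)` is, after the
substitution `s = a + tᵉ`, either identically `0` near `t = 0⁺` or of the form `tᵐ · G(t)` with
`m ∈ ℤ`, `G` real-analytic on `(−r, r)` and `G(0) ≠ 0`.
[Brieskorn–Knörrer 1986, §8.3 (Newton–Puiseux); folklore] -/
theorem stub_puiseuxRight :
    ∀ (f : ℝ → ℝ) (a δ : ℝ), 0 < δ → ContinuousOn f (Set.Ioo a (a + δ)) → (∃ P : MvPolynomial (Fin 2) ℝ, P ≠ 0 ∧ ∀ s ∈ Set.Ioo a (a + δ), MvPolynomial.eval ![s, f s] P = 0) → ∃ (e : ℕ) (r : ℝ), 0 < e ∧ 0 < r ∧ r ^ e ≤ δ ∧ ((∀ t ∈ Set.Ioo (0:ℝ) r, f (a + t ^ e) = 0) ∨ ∃ (m : ℤ) (G : ℝ → ℝ), AnalyticOnNhd ℝ G (Set.Ioo (-r) r) ∧ G 0 ≠ 0 ∧ ∀ t ∈ Set.Ioo (0:ℝ) r, f (a + t ^ e) = t ^ m * G t) := by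
  classical
  rintro f a δ hδ hf ⟨P, hP0, hP⟩
  -- (1) complexify, `x = a + 1/u`
  obtain ⟨Q, hQ0, D, hQ⟩ := puiseuxR_complexify P hP0 a
  -- (2) the atlas of Puiseux branches at infinity
  obtain ⟨e, he, R, r, hr, hr1, B, hBd, hroot⟩ :=
    Literature.Analysis.Complex.PuiseuxInfinity.exists_branch_atlas Q hQ0
  set R' : ℝ := max R 1 with hR'
  have hR'0 : 0 < R' := lt_max_of_lt_right one_pos
  set ρ₀ : ℝ := min r (min δ R'⁻¹) with hρ₀
  have hρ₀0 : 0 < ρ₀ := lt_min hr (lt_min hδ (inv_pos.2 hR'0))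
  have hρ₀r : ρ₀ ≤ r := min_le_left _ _
  have hρ₀δ : ρ₀ ≤ δ := (min_le_right _ _).trans (min_le_left _ _)
  have hρ₀R : ρ₀ ≤ R'⁻¹ := (min_le_right _ _).trans (min_le_right _ _)
  have hpow : ∀ t ∈ Ioo (0:ℝ) ρ₀, 0 < t ^ e ∧ t ^ e ≤ t := fun t ht =>
    ⟨pow_pos ht.1 e, pow_le_of_le_one ht.1.le (ht.2.le.trans (hρ₀r.trans hr1)) he.ne'⟩
  have hkey : ∀ t ∈ Ioo (0:ℝ) ρ₀, a + t ^ e ∈ Ioo a (a + δ) ∧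
      ∃ b ∈ B, ((f (a + t ^ e) : ℝ) : ℂ) = b.1 t / (t : ℂ) ^ b.2 := by
    intro t ht
    obtain ⟨hte0, hte⟩ := hpow t ht
    have hs : a + t ^ e ∈ Ioo a (a + δ) := ⟨by linarith, by linarith [ht.2]⟩
    refine ⟨hs, ?_⟩
    have h1 := hQ (a + t ^ e) (f (a + t ^ e)) (by linarith)
    rw [hP _ hs, Complex.ofReal_zero, mul_zero, add_sub_cancel_left, Complex.ofReal_pow] at h1
    have hnorm : R < ‖((t : ℂ) ^ e)⁻¹‖ := by
      rw [norm_inv, norm_pow, Complex.norm_real, Real.norm_of_nonneg ht.1.le]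
      have h2 : t ^ e < R'⁻¹ := hte.trans_lt (ht.2.trans_le hρ₀R)
      exact (le_max_left R 1).trans_lt ((lt_inv_comm₀ hR'0 hte0).2 h2)
    obtain ⟨-, -, b, hb, hv⟩ := hroot _ _ hnorm h1 (t : ℂ) (inv_inv _).symm
    exact ⟨b, hb, hv⟩
  -- (3a) two candidates agree or disagree identically near `0⁺`
  have hpair : ∀ b ∈ B, ∀ b' ∈ B, ∀ᶠ t : ℝ in 𝓝[>] 0,
      (b.1 t / (t : ℂ) ^ b.2 = b'.1 t / (t : ℂ) ^ b'.2 ↔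
        ∀ᶠ t : ℝ in 𝓝[>] 0, b.1 t / (t : ℂ) ^ b.2 = b'.1 t / (t : ℂ) ^ b'.2) := by
    intro b hb b' hb'
    have h0r : Metric.ball (0 : ℂ) r ∈ 𝓝 (0 : ℂ) := Metric.ball_mem_nhds 0 hr
    have hb1 : AnalyticAt ℂ b.1 0 := (hBd b hb).analyticAt h0r
    have hb1' : AnalyticAt ℂ b'.1 0 := (hBd b' hb').analyticAt h0r
    have hga : AnalyticAt ℂ (fun z => b.1 z * z ^ b'.2 - b'.1 z * z ^ b.2) 0 :=
      (hb1.fun_mul (analyticAt_id.fun_pow _)).fun_sub (hb1'.fun_mul (analyticAt_id.fun_pow _))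
    have hiff : ∀ t : ℝ, 0 < t → (b.1 t / (t : ℂ) ^ b.2 = b'.1 t / (t : ℂ) ^ b'.2 ↔
        b.1 t * (t : ℂ) ^ b'.2 - b'.1 t * (t : ℂ) ^ b.2 = 0) := fun t ht => by
      have ht0 : (t : ℂ) ≠ 0 := Complex.ofReal_ne_zero.2 ht.ne'
      rw [sub_eq_zero, div_eq_div_iff (pow_ne_zero _ ht0) (pow_ne_zero _ ht0)]
    have hpos : ∀ᶠ t : ℝ in 𝓝[>] 0, 0 < t := eventually_mem_nhdsWithin
    rcases puiseuxR_dichotomy hga with h | h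
    · have hC : ∀ᶠ t : ℝ in 𝓝[>] 0, b.1 t / (t : ℂ) ^ b.2 = b'.1 t / (t : ℂ) ^ b'.2 := by
        filter_upwards [h, hpos] with t ht ht0 using (hiff t ht0).2 ht
      exact hC.mono fun t ht => iff_of_true ht hC
    · have hN : ∀ᶠ t : ℝ in 𝓝[>] 0, b.1 t / (t : ℂ) ^ b.2 ≠ b'.1 t / (t : ℂ) ^ b'.2 := by
        filter_upwards [h, hpos] with t ht ht0 using fun h' => ht ((hiff t ht0).1 h')
      refine hN.mono fun t ht => iff_of_false ht fun hC => ?_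
      obtain ⟨s, hs1, hs2⟩ := (hC.and hN).exists
      exact hs2 hs1
  -- (3b) a common interval
  obtain ⟨ρ₁, hρ₁0, hρ₁, hdich⟩ : ∃ ρ₁ : ℝ, 0 < ρ₁ ∧ ρ₁ ≤ ρ₀ ∧ ∀ b ∈ B, ∀ b' ∈ B,
      (∀ t ∈ Ioo (0:ℝ) ρ₁, b.1 t / (t : ℂ) ^ b.2 = b'.1 t / (t : ℂ) ^ b'.2) ∨
      (∀ t ∈ Ioo (0:ℝ) ρ₁, b.1 t / (t : ℂ) ^ b.2 ≠ b'.1 t / (t : ℂ) ^ b'.2) := by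
    have hall := (Filter.eventually_all_finset B).2 fun b hb =>
      (Filter.eventually_all_finset B).2 fun b' hb' => hpair b hb b' hb'
    obtain ⟨u, hu, hsub⟩ := mem_nhdsGT_iff_exists_Ioo_subset.1 hall
    have hmem : ∀ t ∈ Ioo (0:ℝ) (min u ρ₀), ∀ b ∈ B, ∀ b' ∈ B,
        (b.1 t / (t : ℂ) ^ b.2 = b'.1 t / (t : ℂ) ^ b'.2 ↔
          ∀ᶠ t : ℝ in 𝓝[>] 0, b.1 t / (t : ℂ) ^ b.2 = b'.1 t / (t : ℂ) ^ b'.2) :=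
      fun t ht => hsub ⟨ht.1, ht.2.trans_le (min_le_left _ _)⟩
    refine ⟨min u ρ₀, lt_min hu hρ₀0, min_le_right _ _, fun b hb b' hb' => ?_⟩
    by_cases hC : ∀ᶠ t : ℝ in 𝓝[>] 0, b.1 t / (t : ℂ) ^ b.2 = b'.1 t / (t : ℂ) ^ b'.2
    · exact Or.inl fun t ht => (hmem t ht b hb b' hb').2 hC
    · exact Or.inr fun t ht h => hC ((hmem t ht b hb b' hb').1 h)
  -- (3c) selection of ONE branch on `(0, ρ₁)`
  have hIoo : ∀ t ∈ Ioo (0:ℝ) ρ₁, t ∈ Ioo (0:ℝ) ρ₀ := fun t ht => ⟨ht.1, ht.2.trans_le hρ₁⟩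
  have hFc : ContinuousOn (fun t : ℝ => ((f (a + t ^ e) : ℝ) : ℂ)) (Ioo (0:ℝ) ρ₁) := by
    have h1 : ContinuousOn (fun t : ℝ => a + t ^ e) (Ioo (0:ℝ) ρ₁) := by fun_prop
    exact Complex.continuous_ofReal.comp_continuousOn
      (hf.comp h1 fun t ht => (hkey t (hIoo t ht)).1)
  have hHc : ∀ b ∈ B, ContinuousOn (fun t : ℝ => b.1 t / (t : ℂ) ^ b.2) (Ioo (0:ℝ) ρ₁) := by
    intro b hb
    have hnum : ContinuousOn (fun t : ℝ => b.1 t) (Ioo (0:ℝ) ρ₁) := by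
      refine (hBd b hb).continuousOn.comp Complex.continuous_ofReal.continuousOn fun t ht => ?_
      rw [Metric.mem_ball, dist_zero_right, Complex.norm_real, Real.norm_of_nonneg ht.1.le]
      exact ht.2.trans_le (hρ₁.trans hρ₀r)
    have hden : ContinuousOn (fun t : ℝ => (t : ℂ) ^ b.2) (Ioo (0:ℝ) ρ₁) := by fun_prop
    exact hnum.div hden fun t ht => pow_ne_zero _ (Complex.ofReal_ne_zero.2 ht.1.ne')
  obtain ⟨⟨y, M⟩, hyB, hsel⟩ := puiseuxR_select B
    (fun (b : (ℂ → ℂ) × ℕ) (t : ℝ) => b.1 t / (t : ℂ) ^ b.2)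
    (fun t : ℝ => ((f (a + t ^ e) : ℝ) : ℂ)) isOpen_Ioo isPreconnected_Ioo (nonempty_Ioo.2 hρ₁0)
    hFc hHc hdich fun t ht => (hkey t (hIoo t ht)).2
  -- `hsel : ∀ t ∈ Ioo 0 ρ₁, (f (a + t ^ e) : ℂ) = y t / t ^ M`
  have hy0 : AnalyticAt ℂ y 0 := (hBd _ hyB).analyticAt (Metric.ball_mem_nhds 0 hr)
  have htend : Tendsto (fun t : ℝ => (t : ℂ)) (𝓝[>] 0) (𝓝 0) :=
    puiseuxR_tendsto_ofReal.mono_right nhdsWithin_le_nhds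
  have hpowδ : ∀ ρ : ℝ, 0 < ρ → ρ ≤ ρ₁ → ρ ^ e ≤ δ := fun ρ hρ hρ1 =>
    (pow_le_of_le_one hρ.le (hρ1.trans (hρ₁.trans (hρ₀r.trans hr1))) he.ne').trans
      (hρ1.trans (hρ₁.trans hρ₀δ))
  -- (4) normal form
  by_cases htop : analyticOrderAt y 0 = ⊤
  · -- `y` vanishes identically near `0`: first alternative
    have h0 : ∀ᶠ t : ℝ in 𝓝[>] 0, y t = 0 := htend.eventually (analyticOrderAt_eq_top.1 htop)
    obtain ⟨u, hu, hsub⟩ := mem_nhdsGT_iff_exists_Ioo_subset.1 h0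
    refine ⟨e, min u ρ₁, he, lt_min hu hρ₁0, hpowδ _ (lt_min hu hρ₁0) (min_le_right _ _),
      Or.inl fun t ht => ?_⟩
    have h1 := hsel t ⟨ht.1, ht.2.trans_le (min_le_right _ _)⟩
    have h2 : y t = 0 := hsub ⟨ht.1, ht.2.trans_le (min_le_left _ _)⟩
    dsimp only at h1
    rw [h2, zero_div] at h1
    exact_mod_cast h1
  · obtain ⟨g, hg, hg0, hfac⟩ := hy0.analyticOrderAt_ne_top.1 htop
    set N : ℕ := analyticOrderNatAt y 0 with hN
    obtain ⟨ε, hε, hgε⟩ := hg.exists_ball_analyticOnNhd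
    have h0 : ∀ᶠ t : ℝ in 𝓝[>] 0, y t = (t : ℂ) ^ N * g t := by
      filter_upwards [htend.eventually hfac] with t ht
      simp only [ht, sub_zero, smul_eq_mul]
    obtain ⟨u, hu, hsub⟩ := mem_nhdsGT_iff_exists_Ioo_subset.1 h0
    set ρ : ℝ := min u (min ρ₁ ε) with hρ
    have hρ0 : 0 < ρ := lt_min hu (lt_min hρ₁0 hε)
    have hρu : ρ ≤ u := min_le_left _ _
    have hρ1 : ρ ≤ ρ₁ := (min_le_right _ _).trans (min_le_left _ _)
    have hρε : ρ ≤ ε := (min_le_right _ _).trans (min_le_right _ _)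
    -- `g` is real on `(0, ρ)`
    have hreal : ∀ t ∈ Ioo (0:ℝ) ρ, g t = ((f (a + t ^ e) * t ^ M / t ^ N : ℝ) : ℂ) := by
      intro t ht
      have ht0 : (t : ℂ) ≠ 0 := Complex.ofReal_ne_zero.2 ht.1.ne'
      have h1 := hsel t ⟨ht.1, ht.2.trans_le hρ1⟩
      have h2 : y t = (t : ℂ) ^ N * g t := hsub ⟨ht.1, ht.2.trans_le hρu⟩
      dsimp only at h1
      rw [h2] at h1
      push_cast
      rw [h1]
      field_simp
    have him : ∀ t ∈ Ioo (0:ℝ) ρ, (g t).im = 0 := fun t ht => by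
      rw [hreal t ht, Complex.ofReal_im]
    have him0 : (g 0).im = 0 := by
      have hg' : AnalyticAt ℂ g ((0 : ℝ) : ℂ) := by rwa [Complex.ofReal_zero]
      have h1 : Tendsto (fun t : ℝ => (g t).im) (𝓝[>] 0) (𝓝 (g ((0 : ℝ) : ℂ)).im) :=
        hg'.im_ofReal.continuousAt.tendsto.mono_left nhdsWithin_le_nhds
      have h2 : Tendsto (fun t : ℝ => (g t).im) (𝓝[>] 0) (𝓝 0) :=
        tendsto_const_nhds.congr'
          (by filter_upwards [Ioo_mem_nhdsGT hρ0] with t ht using (him t ht).symm)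
      have h3 := tendsto_nhds_unique h1 h2
      rwa [Complex.ofReal_zero] at h3
    refine ⟨e, ρ, he, hρ0, hpowδ ρ hρ0 hρ1, Or.inr ⟨(N : ℤ) - M, fun t => (g t).re, ?_, ?_, ?_⟩⟩
    · intro t ht
      have hmem : (t : ℂ) ∈ Metric.ball (0 : ℂ) ε := by
        rw [Metric.mem_ball, dist_zero_right, Complex.norm_real, Real.norm_eq_abs, abs_lt]
        exact ⟨by linarith [ht.1, hρε], ht.2.trans_le hρε⟩
      exact (hgε _ hmem).re_ofReal
    · intro h
      apply hg0
      exact Complex.ext (by simpa using h) (by simpa using him0)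
    · intro t ht
      have ht0 : (t : ℝ) ≠ 0 := ht.1.ne'
      dsimp only
      rw [hreal t ht, Complex.ofReal_re, zpow_sub₀ ht0, zpow_natCast, zpow_natCast]
      field_simp

end Summit.KontsevichZagierPeriods.FurushoPentagon.SectorToKernel
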